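import Mathlib
import Summits.Ventures.PercRepro.TriangleCapFiveBelowThree
import Summits.Ventures.PercRepro.TriangleCapEightThirteenH
import Summits.Ventures.PercRepro.TriangleCapNineSixteenA
import Summits.Ventures.PercRepro.TriangleCapTwoBelowDiagonalTen
import Summits.Ventures.PercRepro.TriangleCapThreeBelowDiagonalTen

/-!
# PercRepro — THE ROW `a = 3` OF THE CLOSED FORM: THE BASE ROWS `r = 2, 3, 4` ON EVERY VERTEX TYPE (p3, gen 40;
part 151)

The sub-diagonals `r ≤ 4` of the row `a = 3` (`m = 3 (k − 3) − r`), landed in gens 35–40 cell by cell and with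
bipartition hypotheses, restated uniformly: `three_row_base (r) (hr : 2 ≤ r) (hr4 : r ≤ 4) (hk : 6 + r ≤ k)
(hm : m + 9 + r = 3k) : Σ_v d(v)² + r (k − 1 − r) ≤ m k` on every finite vertex type — the base of the induction on
`r` of part 153 (the band `2k − 3 ≤ m ≤ 3k − 9`). The bipartition hypotheses are discharged by the products
(`not_bip_of_card_eq` for `k = 8, 9` by `decide`; `not_bip_of_three_row` from `k = 10`). Axioms: standard.
-/

namespace PercRepro

namespace TriangleCap

namespace C047

open Finset

variable {V : Type*} [Fintype V] [DecidableEq V]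

/-- No bipartition with `≤ N` missing pairs when `m, …, m + N` are not products `a′ (k − a′)`. -/
theorem not_bip_of_card_eq (D : SimpleGraph V) [DecidableRel D.Adj] (k m N : ℕ) (hk : Fintype.card V = k)
    (hm : D.edgeFinset.card = m) (hprod : ∀ a', a' ≤ k → ∀ i, i ≤ N → m + i ≠ a' * (k - a')) :
    ¬ ∃ A : Finset V, (∀ x y, D.Adj x y → (x ∈ A ↔ y ∉ A)) ∧ (missing D A Aᶜ).card ≤ N := by
  rintro ⟨A, hA, hN⟩
  have hNX := card_missing_add_card_edges D A hA
  have hXc : Aᶜ.card = k - A.card := by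
    have := card_add_card_compl A
    omega
  have hXk : A.card ≤ k := by
    have := card_le_univ A
    omega
  rw [hXc, hm] at hNX
  exact hprod A.card hXk (missing D A Aᶜ).card hN (by omega)

/-- **THE ROW `r = 2`** (`m = 3k − 11`) for every `k ≥ 8`: `Σ_v d(v)² + 2 (k − 3) ≤ m k`. -/
theorem three_row_two (D : SimpleGraph V) [DecidableRel D.Adj] (hK : K4mFree D) (hk : 8 ≤ Fintype.card V)
    (hm : D.edgeFinset.card + 11 = 3 * Fintype.card V) :
    ∑ v, deg D v * deg D v + 2 * (Fintype.card V - 3) ≤ D.edgeFinset.card * Fintype.card V := by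
  rcases Nat.lt_or_ge (Fintype.card V) 10 with h | h
  · rcases Nat.lt_or_ge (Fintype.card V) 9 with h8 | h9
    · have hk8 : Fintype.card V = 8 := by omega
      have hm13 : D.edgeFinset.card = 13 := by omega
      exact dense_stability_two_eight_thirteen D hK hk8 hm13 (not_bip_of_card_eq D 8 13 1 hk8 hm13 (by decide))
    · have hk9 : Fintype.card V = 9 := by omega
      have hm16 : D.edgeFinset.card = 16 := by omega
      exact dense_stability_two_nine_sixteen D hK hk9 hm16 (not_bip_of_card_eq D 9 16 1 hk9 hm16 (by decide))
  · exact dense_stability_two_of_ten D hK h (by omega) (not_bip_of_three_row D h 1 (by norm_num) (by omega))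

/-- **THE ROW `r = 3`** (`m = 3k − 12`) for every `k ≥ 9`: `Σ_v d(v)² + 3 (k − 4) ≤ m k`. -/
theorem three_row_three (D : SimpleGraph V) [DecidableRel D.Adj] (hK : K4mFree D) (hk : 9 ≤ Fintype.card V)
    (hm : D.edgeFinset.card + 12 = 3 * Fintype.card V) :
    ∑ v, deg D v * deg D v + 3 * (Fintype.card V - 4) ≤ D.edgeFinset.card * Fintype.card V := by
  rcases Nat.lt_or_ge (Fintype.card V) 10 with h | h
  · have hk9 : Fintype.card V = 9 := by omega
    have hm15 : D.edgeFinset.card = 15 := by omega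
    exact dense_stability_three_nine_fifteen D hK hk9 hm15 (not_bip_of_card_eq D 9 15 2 hk9 hm15 (by decide))
  · exact dense_stability_three_of_ten D hK h (by omega) (by omega) (Or.inr (Or.inl (by omega)))
      (not_bip_of_three_row D h 2 (by norm_num) (by omega))

/-- **THE BASE ROWS `r = 2, 3, 4`** of the row `a = 3`: `6 + r ≤ k`, `m + 9 + r = 3k` ⇒
`Σ_v d(v)² + r (k − 1 − r) ≤ m k`. -/
theorem three_row_base (D : SimpleGraph V) [DecidableRel D.Adj] (hK : K4mFree D) (r : ℕ) (hr2 : 2 ≤ r)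
    (hr4 : r ≤ 4) (hk : 6 + r ≤ Fintype.card V) (hm : D.edgeFinset.card + 9 + r = 3 * Fintype.card V) :
    ∑ v, deg D v * deg D v + r * (Fintype.card V - 1 - r) ≤ D.edgeFinset.card * Fintype.card V := by
  interval_cases r
  · have := three_row_two D hK (by omega) (by omega)
    have e : Fintype.card V - 1 - 2 = Fintype.card V - 3 := by omega
    rw [e]
    exact this
  · have := three_row_three D hK (by omega) (by omega)
    have e : Fintype.card V - 1 - 3 = Fintype.card V - 4 := by omega
    rw [e]
    exact this
  · have := dense_stability_four_three_ten D hK (by omega) (by omega)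
    have e : Fintype.card V - 1 - 4 = Fintype.card V - 5 := by omega
    rw [e]
    exact this

end C047

end TriangleCap

end PercRepro
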